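import Literature.NumberTheory.Automorphic.Liu2021.ThetaLiftFromLineSeamRescale
import Summits.HodgeConjecture.HodgeConjecture.Theorems.K2LiuLineThetaKernelMirror
import HarnessLib

/-!
# The line-theta KERNEL under a rational change of frame of `V`, under the W-rescaling `(c • d_V, ⟨a⟩) ≡ (d_V, ⟨c·a⟩)`, and under equal data
# — organ (O44f) of socket #44∕45R (the kernel-level form of ★ `MeetsThetaLiftFromLine.frameTransport` ∕ ★ `MeetsThetaLiftFromLine.rescale`)

Track B ∕ hLiu418 = stmt-HodgeConjecture-24832, line `K2_Liu_CurveThetaSigs`, unit U6 ED. 6, socket #44∕45R `sig_K2LiuUndoublingSeparation`;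
seat `hodgecm-mathlib-K2Liu-p03` (g3).  After undoubling (★ `K2LiuDoubledKernelUndoubling.lineThetaKer_dD_blockDiag`) the two slots are
line-theta kernels at the frames `dD ∘ castAdd = (d_V ∘ x)·1` and `dD ∘ natAdd = −(d_V ∘ x)·1` (`x k = (e₁⁻¹ k).1`, a permutation of the
`V`-coordinates); the socket's conclusion is written at the frame `d_V`.  The LD1 lineage proved the needed transports at the SEAM level
(`MeetsThetaLiftFromLine.frameTransport ∕ .rescale`); this file records them at the level the assembler of #44∕45R needs — the KERNEL
`θ_Φ(mk k, mk u)` of ★ `lineThetaKernelDatum` — with the same proofs (★ `hω_of_T4` + ★ `conjSplitting_doubledWeilRep_comp_thetaD` [Kudla1994,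
Thm. 3.1: the `χ`-normalised doubled Weil representation is unique, so it commutes with rational isometries]; ★ `pairRep_rescale`; ★
`thetaKernelDatum_thetaFun_eq_of_intertwiner`):

* §1 `lineThetaKer_frameTransport` — for real diagonal frames `d_V′`, `d_V` related by a rational ISOMETRY `B` (`ᵗ(c̄B)·(diag d_V′)·B = diag d_V`):
  there is a linear `R : 𝒮(𝔸^{n}) → 𝒮(𝔸^{n})` (`R_{e₁} ∘ ω(r_Kron) ∘ R_{e₁}⁻¹`, Weil's Θ-fixing rational lift) with
  `θ_{d_V′,Φ}(mk k, mk u) = θ_{d_V,RΦ}(mk (B⁻¹ k B), mk u)` for ALL `Φ, k, u` ([Liu2021, App. D §D.1 Step 1 footnote: «the isomorphism class of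
  `ω(μ, ε, χ)` depends only on `(μ, ε, χ)`»]);
* §2 `lineThetaKer_rescale` — `θ_{c•d_V,⟨a⟩,Φ}(mk k, mk u) = θ_{d_V,⟨c·a⟩,Φ}(mk k, mk u)` (identity retypings; `c ∈ (L⁺)^×`, e.g. `c = −1`: `(−d_V, ⟨a⟩) ≡ (d_V, ⟨−a⟩)`);
* §3 `lineThetaKer_frame_congr`, `lineThetaKer_line_congr` — equal frames ∕ equal lines give equal kernels (the `subst` bookkeeping the assembler
  needs to read `dD ∘ castAdd`, `dD ∘ natAdd`, `(−1)·a′` in the letter's spelling).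

No definition, no instance, no named fact, no `sorry`; axioms ⊆ {propext, Classical.choice, Quot.sound}.

## References
* [Liu2021] Y. Liu, *Fourier–Jacobi cycles and arithmetic relative trace formula*, Camb. J. Math. 9 (2021), Def. 4.11; App. D §D.1 Step 1 (footnote l. 5215).
* [GelbartRogawski1991] S. Gelbart, J. Rogawski, Invent. Math. 105 (1991), §3.1 Prop. 3.1.1 p. 455, Remark p. 457; §3.2 p. 457.
* [Kudla1994] S. Kudla, Israel J. Math. 87 (1994), §2, §3 Thm. 3.1.
* [Weil1964] A. Weil, Acta Math. 111 (1964), Chap. III n° 40–41, Thm. 6 p. 193.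
* [PlatonovRapinchuk1994] V. Platonov, A. Rapinchuk, *Algebraic Groups and Number Theory* (1994), §5.1.

HONEST LABEL: HC_CM is proved only modulo the 7 printed citations (2 remaining named inputs: hLiu418 = stmt-HodgeConjecture-24832, h413 =
stmt-HodgeConjecture-24833) until rung 0 closes; this helper moves no counter.
-/

set_option autoImplicit false

set_option linter.dupNamespace false

noncomputable section

open scoped Classical
open scoped Matrix Kronecker
open NumberField IsDedekindDomain
open Literature.RepresentationTheory.HeisenbergGroup
open Literature.NumberTheory.Automorphic
open Literature.NumberTheory.Weil1964
open Literature.NumberTheory.GaloisRepresentations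
open Literature.RepresentationTheory.HarrisKudlaSweet1996

namespace Summit.HodgeConjecture.HodgeConjecture.Cruxes.HLiu418.K2LiuLineThetaKernelFrameTransport

open Literature.NumberTheory.Automorphic.UnitaryGroup
open Literature.NumberTheory.Automorphic.IdeleClassGroup
open Literature.NumberTheory.GelbartRogawski1991 Literature.NumberTheory.GelbartRogawski1991.UnitaryDualPair
open Literature.NumberTheory.GelbartRogawski1991.GRConstruction
open Literature.NumberTheory.Automorphic.Liu2021 Literature.NumberTheory.Automorphic.Liu2021.Def411WeilCarriers
open Literature.NumberTheory.Automorphic.Liu2021.Def411WeilCarriersDoubling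
open Literature.RepresentationTheory.Liu2021
open Summit.HodgeConjecture.HodgeConjecture.Cruxes.HLiu418.K2LiuLineThetaKernelMirror (lineThetaKer_mk_eq_thetaDistLM)

variable (L : Type) [Field L] [NumberField L] [IsCMField L] (N : ℕ) {n₂ : ℕ} (e₁ : Fin N × Fin 1 ≃ Fin n₂)
  (dV' : Fin N → L) (hdV' : ∀ i, IsCMField.complexConj L (dV' i) = dV' i) (hdV'0 : ∀ i, dV' i ≠ 0)
  (dV : Fin N → L) (hdV : ∀ i, IsCMField.complexConj L (dV i) = dV i) (hdV0 : ∀ i, dV i ≠ 0)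
  (μ : Literature.NumberTheory.Automorphic.IdeleClassGroup L →ₜ* Circle) (hμ : IsConjugateSymplectic L μ)
  (a : (Fp L)ˣ)

/-! ## §1 The kernel under a rational change of frame of `V` -/

/-- **THE LINE-THETA KERNEL DOES NOT SEE THE RATIONAL FRAME OF `V`.**  For two real diagonal frames `d_V′`, `d_V` related by a rational ISOMETRY `B`
(`ᵗ(c̄B)·(1 • diag d_V′)·B = diag d_V`) and the same line `⟨a⟩` and character `μ` (Weil majorants `hρ′`, `hρ` at the two frames): there is a ℂ-linear
`R : 𝒮(𝔸^{n}) → 𝒮(𝔸^{n})` with `θ_{d_V′,Φ}(mk k, mk u) = θ_{d_V,RΦ}(mk (Ad(B⁻¹ ⊗ 1) k), mk u)` for all `Φ, k, u` (`Ad(B⁻¹ ⊗ 1)` = ★ `adelicIsometryConj (aOfB B)`).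
PROOF = the operator identity of ★ `MeetsThetaLiftFromLine.frameTransport` (★ `hω_of_T4` at the hypothesis-free doubled isometry transport ★
`conjSplitting_doubledWeilRep_comp_thetaD`, read at the line through ★ `omega_pairSplitting_chiSplittingLine`), `R := R_{e₁} ∘ ω(r_Kron) ∘ R_{e₁}⁻¹`
(`Θ ∘ R = Θ`: ★ `thetaDist_omega_ratPointsThetaLiftCont`), fed to ★ `thetaKernelDatum_thetaFun_eq_of_intertwiner` at `θ_W := id`.
[cite: Liu2021, Def. 4.11 (l. 2092–2096); App. D §D.1 Step 1 (footnote l. 5215)] [cite: GelbartRogawski1991, §3.1 Prop. 3.1.1 p. 455, Remark p. 457; §3.2 p. 457]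
[cite: Kudla1994, §3 Thm. 3.1] [cite: Weil1964, Chap. III n° 41 Thm 6 p. 193] -/
theorem lineThetaKer_frameTransport (B : GL (Fin N) L)
    (hB : formCongr ((IsCMField.complexConj L : L ≃ₐ[Fp L] L) : L →+* L) B ((1 : L) • Matrix.diagonal dV') = Matrix.diagonal dV)
    (hρ' : HasThetaMajorants fun
      (p : ↥(UnitaryGroup.adelic (Fp L) L (IsCMField.complexConj L) N (Matrix.diagonal dV')) ×
        ↥(UnitaryGroup.adelic (Fp L) L (IsCMField.complexConj L) 1 (JW (Fp L) L a)))
      (Φ : piSchwartzBruhat (Fp L) (Fin n₂)) =>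
        pairRep (Fp L) L (IsCMField.complexConj L) N 1 e₁ (Matrix.diagonal dV') (JW (Fp L) L a)
          (chiSplittingLine L e₁ dV' hdV' hdV'0 (toHeckeCharacter L μ) (isUnitary_toHeckeCharacter L μ)
            ((isOscillatorChar_toHeckeCharacter_iff μ).mpr hμ) (TW (Fp L) a)
            (isUnit_det_TW (Fp L) a) (JW (Fp L) L a) (JW_eq (Fp L) L a))
          p Φ)
    (hρ : HasThetaMajorants fun
      (p : ↥(UnitaryGroup.adelic (Fp L) L (IsCMField.complexConj L) N (Matrix.diagonal dV)) ×
        ↥(UnitaryGroup.adelic (Fp L) L (IsCMField.complexConj L) 1 (JW (Fp L) L a)))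
      (Φ : piSchwartzBruhat (Fp L) (Fin n₂)) =>
        pairRep (Fp L) L (IsCMField.complexConj L) N 1 e₁ (Matrix.diagonal dV) (JW (Fp L) L a)
          (chiSplittingLine L e₁ dV hdV hdV0 (toHeckeCharacter L μ) (isUnitary_toHeckeCharacter L μ)
            ((isOscillatorChar_toHeckeCharacter_iff μ).mpr hμ) (TW (Fp L) a)
            (isUnit_det_TW (Fp L) a) (JW (Fp L) L a) (JW_eq (Fp L) L a))
          p Φ) :
    ∃ R : piSchwartzBruhat (Fp L) (Fin n₂) →ₗ[ℂ] piSchwartzBruhat (Fp L) (Fin n₂),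
      ∀ (Φ : piSchwartzBruhat (Fp L) (Fin n₂)) (k : UnitaryGroup.adelic (Fp L) L (IsCMField.complexConj L) N (Matrix.diagonal dV'))
        (u : UnitaryGroup.adelic (Fp L) L (IsCMField.complexConj L) 1 (JW (Fp L) L a)),
        (lineThetaKernelDatum L N e₁ dV' hdV' hdV'0 μ hμ a hρ').thetaKer Φ (QuotientGroup.mk k, QuotientGroup.mk u) =
          (lineThetaKernelDatum L N e₁ dV hdV hdV0 μ hμ a hρ).thetaKer (R Φ)
            (QuotientGroup.mk (adelicIsometryConj (Fp L) L (IsCMField.complexConj L) N (aOfB L B) (aOfB_isometry L dV dV' B hB) k),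
              QuotientGroup.mk u) := by
  -- the model W-frame of the line, the rational Gram transporter, Weil's Θ-fixing lift at the Kronecker index
  obtain ⟨C₀, C, hCC₀, hC⟩ := exists_gramTransporter L dV hdV hdV0 dV' hdV' hdV'0 (lineW L (TW (Fp L) a))
    (complexConj_lineW L (TW (Fp L) a)) (lineW_ne_zero L (TW (Fp L) a) (isUnit_det_TW (Fp L) a))
  have hω := hω_of_T4 L e₁ dV hdV hdV0 dV' hdV' hdV'0 (lineW L (TW (Fp L) a)) (complexConj_lineW L (TW (Fp L) a))
    (lineW_ne_zero L (TW (Fp L) a) (isUnit_det_TW (Fp L) a)) B hB hCC₀ hC (toHeckeCharacter L μ) (isUnitary_toHeckeCharacter L μ)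
    ((isOscillatorChar_toHeckeCharacter_iff μ).mpr hμ)
    (conjSplitting_doubledWeilRep_comp_thetaD L e₁ dV hdV hdV0 dV' hdV' hdV'0 (lineW L (TW (Fp L) a))
      (complexConj_lineW L (TW (Fp L) a)) (lineW_ne_zero L (TW (Fp L) a) (isUnit_det_TW (Fp L) a)) hCC₀ hC B hB
      (toHeckeCharacter L μ) (isUnitary_toHeckeCharacter L μ) ((isOscillatorChar_toHeckeCharacter_iff μ).mpr hμ))
  let R : piSchwartzBruhat (Fp L) (Fin n₂) →ₗ[ℂ] piSchwartzBruhat (Fp L) (Fin n₂) :=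
    (piSBReindex (Fp L) e₁).toLinearMap ∘ₗ
      (adelicMpCont.omega (Fp L) (Fin N × Fin 1) _
        (rKron L dV hdV hdV0 dV' hdV' (lineW L (TW (Fp L) a)) (complexConj_lineW L (TW (Fp L) a))
          (lineW_ne_zero L (TW (Fp L) a) (isUnit_det_TW (Fp L) a)) (coe_aOfB L B) (aOfB_isometry L dV dV' B hB) hCC₀ hC)) ∘ₗ
      (piSBReindex (Fp L) e₁).symm.toLinearMap
  have hRapp : ∀ Φ, R Φ = piSBReindex (Fp L) e₁ (adelicMpCont.omega (Fp L) (Fin N × Fin 1) _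
      (rKron L dV hdV hdV0 dV' hdV' (lineW L (TW (Fp L) a)) (complexConj_lineW L (TW (Fp L) a))
        (lineW_ne_zero L (TW (Fp L) a) (isUnit_det_TW (Fp L) a)) (coe_aOfB L B) (aOfB_isometry L dV dV' B hB) hCC₀ hC)
      ((piSBReindex (Fp L) e₁).symm Φ)) :=
    fun _ => rfl
  -- `Θ ∘ R = Θ`
  have hΘ : ∀ Ψ : piSchwartzBruhat (Fp L) (Fin n₂), thetaDistLM (Fp L) (Fin n₂) (R Ψ) = thetaDistLM (Fp L) (Fin n₂) Ψ := fun Ψ => by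
    have hfix : thetaDist (Fp L) (Fin N × Fin 1)
        ((adelicMpCont.omega (Fp L) (Fin N × Fin 1) _
          (rKron L dV hdV hdV0 dV' hdV' (lineW L (TW (Fp L) a)) (complexConj_lineW L (TW (Fp L) a))
            (lineW_ne_zero L (TW (Fp L) a) (isUnit_det_TW (Fp L) a)) (coe_aOfB L B) (aOfB_isometry L dV dV' B hB) hCC₀ hC)
          ((piSBReindex (Fp L) e₁).symm Ψ) : piSchwartzBruhat (Fp L) (Fin N × Fin 1)) :
          (Fin N × Fin 1 → AdeleRing (𝓞 (Fp L)) (Fp L)) → ℂ) =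
        thetaDist (Fp L) (Fin N × Fin 1)
          (((piSBReindex (Fp L) e₁).symm Ψ : piSchwartzBruhat (Fp L) (Fin N × Fin 1)) :
            (Fin N × Fin 1 → AdeleRing (𝓞 (Fp L)) (Fp L)) → ℂ) :=
      thetaDist_omega_ratPointsThetaLiftCont (Fp L) (Fin N × Fin 1) _ _ _ _
    rw [hRapp, thetaDistLM_piSBReindex, thetaDistLM_apply, hfix, ← thetaDistLM_apply, piSBReindex_symm, thetaDistLM_piSBReindex]
  -- the operator identity at the line, from `hω_of_T4` through the bridge
  have hR : ∀ (k : ↥(UnitaryGroup.adelic (Fp L) L (IsCMField.complexConj L) N (Matrix.diagonal dV')))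
      (u : ↥(UnitaryGroup.adelic (Fp L) L (IsCMField.complexConj L) 1 (JW (Fp L) L a))) (Φ : piSchwartzBruhat (Fp L) (Fin n₂)),
      R (pairRep (Fp L) L (IsCMField.complexConj L) N 1 e₁ (Matrix.diagonal dV') (JW (Fp L) L a)
          (chiSplittingLine L e₁ dV' hdV' hdV'0 (toHeckeCharacter L μ) (isUnitary_toHeckeCharacter L μ)
            ((isOscillatorChar_toHeckeCharacter_iff μ).mpr hμ) (TW (Fp L) a) (isUnit_det_TW (Fp L) a) (JW (Fp L) L a) (JW_eq (Fp L) L a))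
          (k, u) Φ) =
        pairRep (Fp L) L (IsCMField.complexConj L) N 1 e₁ (Matrix.diagonal dV) (JW (Fp L) L a)
          (chiSplittingLine L e₁ dV hdV hdV0 (toHeckeCharacter L μ) (isUnitary_toHeckeCharacter L μ)
            ((isOscillatorChar_toHeckeCharacter_iff μ).mpr hμ) (TW (Fp L) a) (isUnit_det_TW (Fp L) a) (JW (Fp L) L a) (JW_eq (Fp L) L a))
          (adelicIsometryConj (Fp L) L (IsCMField.complexConj L) N (aOfB L B) (aOfB_isometry L dV dV' B hB) k,
            (MonoidHom.id _) u) (R Φ) := fun k u Φ => by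
    have h1 := omega_pairSplitting_chiSplittingLine L e₁ dV' hdV' hdV'0 (toHeckeCharacter L μ) (isUnitary_toHeckeCharacter L μ)
      ((isOscillatorChar_toHeckeCharacter_iff μ).mpr hμ) (TW (Fp L) a) (isUnit_det_TW (Fp L) a) (JW (Fp L) L a) (JW_eq (Fp L) L a) k u Φ
    have h2 := omega_pairSplitting_chiSplittingLine L e₁ dV hdV hdV0 (toHeckeCharacter L μ) (isUnitary_toHeckeCharacter L μ)
      ((isOscillatorChar_toHeckeCharacter_iff μ).mpr hμ) (TW (Fp L) a) (isUnit_det_TW (Fp L) a) (JW (Fp L) L a) (JW_eq (Fp L) L a)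
      (adelicIsometryConj (Fp L) L (IsCMField.complexConj L) N (aOfB L B) (aOfB_isometry L dV dV' B hB) k) u (R Φ)
    have h3 := hω
      (adelicInl (Fp L) L (IsCMField.complexConj L) N 1 (Matrix.diagonal dV') (Matrix.diagonal (lineW L (TW (Fp L) a))) k *
        adelicInr (Fp L) L (IsCMField.complexConj L) N 1 (Matrix.diagonal dV') (Matrix.diagonal (lineW L (TW (Fp L) a)))
          ((MulEquiv.subgroupCongr (congrArg (UnitaryGroup.adelic (Fp L) L (IsCMField.complexConj L) 1)
            (diagonal_lineW L (TW (Fp L) a) (JW_eq (Fp L) L a)))).symm u))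
      ((piSBReindex (Fp L) e₁).symm Φ)
    have hΦ : (piSBReindex (Fp L) e₁) ((piSBReindex (Fp L) e₁).symm Φ) = Φ := LinearEquiv.apply_symm_apply _ _
    have hconj : adelicPairIsometryConjLeft (Fp L) L (IsCMField.complexConj L) N 1 (aOfB L B) (aOfB_isometry L dV dV' B hB)
        (adelicInl (Fp L) L (IsCMField.complexConj L) N 1 (Matrix.diagonal dV') (Matrix.diagonal (lineW L (TW (Fp L) a))) k *
          adelicInr (Fp L) L (IsCMField.complexConj L) N 1 (Matrix.diagonal dV') (Matrix.diagonal (lineW L (TW (Fp L) a)))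
            ((MulEquiv.subgroupCongr (congrArg (UnitaryGroup.adelic (Fp L) L (IsCMField.complexConj L) 1)
              (diagonal_lineW L (TW (Fp L) a) (JW_eq (Fp L) L a)))).symm u)) =
        adelicInl (Fp L) L (IsCMField.complexConj L) N 1 (Matrix.diagonal dV) (Matrix.diagonal (lineW L (TW (Fp L) a)))
            (adelicIsometryConj (Fp L) L (IsCMField.complexConj L) N (aOfB L B) (aOfB_isometry L dV dV' B hB) k) *
          adelicInr (Fp L) L (IsCMField.complexConj L) N 1 (Matrix.diagonal dV) (Matrix.diagonal (lineW L (TW (Fp L) a)))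
            ((MulEquiv.subgroupCongr (congrArg (UnitaryGroup.adelic (Fp L) L (IsCMField.complexConj L) 1)
              (diagonal_lineW L (TW (Fp L) a) (JW_eq (Fp L) L a)))).symm u) := by
      rw [map_mul, adelicPairIsometryConjLeft_adelicInl, adelicPairIsometryConjLeft_adelicInr]
    simp only [hΦ, hconj] at h3
    have hA := (pairRep_apply (Fp L) L (IsCMField.complexConj L) N 1 e₁ (Matrix.diagonal dV') (JW (Fp L) L a)
      (chiSplittingLine L e₁ dV' hdV' hdV'0 (toHeckeCharacter L μ) (isUnitary_toHeckeCharacter L μ)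
        ((isOscillatorChar_toHeckeCharacter_iff μ).mpr hμ) (TW (Fp L) a) (isUnit_det_TW (Fp L) a) (JW (Fp L) L a) (JW_eq (Fp L) L a))
      (k, u) Φ).trans h1
    simp only [pairSplitting_apply] at hA
    have hB' := (pairRep_apply (Fp L) L (IsCMField.complexConj L) N 1 e₁ (Matrix.diagonal dV) (JW (Fp L) L a)
      (chiSplittingLine L e₁ dV hdV hdV0 (toHeckeCharacter L μ) (isUnitary_toHeckeCharacter L μ)
        ((isOscillatorChar_toHeckeCharacter_iff μ).mpr hμ) (TW (Fp L) a) (isUnit_det_TW (Fp L) a) (JW (Fp L) L a) (JW_eq (Fp L) L a))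
      (adelicIsometryConj (Fp L) L (IsCMField.complexConj L) N (aOfB L B) (aOfB_isometry L dV dV' B hB) k, u) (R Φ)).trans h2
    simp only [pairSplitting_apply] at hB'
    have hu : (MonoidHom.id (↥(UnitaryGroup.adelic (Fp L) L (IsCMField.complexConj L) 1 (JW (Fp L) L a)))) u = u := rfl
    simp only [hu, hB']
    simp only [hA, hRapp, h3, LinearEquiv.apply_symm_apply]
  refine ⟨R, fun Φ k u => ?_⟩
  -- the kernels agree along the Θ-fixing intertwiner `R` (★ `thetaKernelDatum_thetaFun_eq_of_intertwiner`), read on `thetaKer (mk ·, mk ·)`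
  have key := thetaKernelDatum_thetaFun_eq_of_intertwiner
    (hs' := isCompatible_chiSplittingLine L e₁ dV' hdV' hdV'0 (toHeckeCharacter L μ) (isUnitary_toHeckeCharacter L μ)
      ((isOscillatorChar_toHeckeCharacter_iff μ).mpr hμ) (TW (Fp L) a) (isSymm_TW (Fp L) a) (isUnit_det_TW (Fp L) a) (JW (Fp L) L a)
      (JW_eq (Fp L) L a)) (hρ' := hρ') (SK' := Set.univ) (hSK' := fun _ _ _ => Set.mem_univ _)
    (hs := isCompatible_chiSplittingLine L e₁ dV hdV hdV0 (toHeckeCharacter L μ) (isUnitary_toHeckeCharacter L μ)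
      ((isOscillatorChar_toHeckeCharacter_iff μ).mpr hμ) (TW (Fp L) a) (isSymm_TW (Fp L) a) (isUnit_det_TW (Fp L) a) (JW (Fp L) L a)
      (JW_eq (Fp L) L a)) (hρ := hρ) (SK := Set.univ) (hSK := fun _ _ _ => Set.mem_univ _)
    (hcδ := complexConj_imagUnit L) (hδ := imagUnit_ne_zero L) (hd := imagUnit_mul_self L)
    (hV' := realDiagonal_isSymm L dV' hdV') (hVd' := isUnit_det_realDiagonal L dV' hdV' hdV'0) (hJV' := (realDiagonal_map L dV' hdV').symm)
    (hV := realDiagonal_isSymm L dV hdV) (hVd := isUnit_det_realDiagonal L dV hdV hdV0) (hJV := (realDiagonal_map L dV hdV).symm)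
    (adelicIsometryConj (Fp L) L (IsCMField.complexConj L) N (aOfB L B) (aOfB_isometry L dV dV' B hB))
    (MonoidHom.id (↥(UnitaryGroup.adelic (Fp L) L (IsCMField.complexConj L) 1 (JW (Fp L) L a)))) R hΘ hR Φ k u
  have key' : (lineThetaKernelDatum L N e₁ dV' hdV' hdV'0 μ hμ a hρ').thetaFun Φ (k, u) =
      (lineThetaKernelDatum L N e₁ dV hdV hdV0 μ hμ a hρ).thetaFun (R Φ)
        (adelicIsometryConj (Fp L) L (IsCMField.complexConj L) N (aOfB L B) (aOfB_isometry L dV dV' B hB) k, u) := key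
  -- `thetaKer Φ (mk x, mk y)` is `thetaFun Φ (x, y)` by `rfl` (★ `ThetaKernelDatum.thetaKer_mk` ∕ `thetaFun_apply`)
  exact key'

/-! ## §2 The kernel under the W-rescaling `(c • d_V, ⟨a⟩) ≡ (d_V, ⟨c·a⟩)` -/

/-- **`θ_{c•d_V,⟨a⟩,Φ}(mk k, mk u) = θ_{d_V,⟨c·a⟩,Φ}(mk k, mk u)`** (identity retypings `U(diag(c•d_V))(𝔸) = U(diag d_V)(𝔸)`, `U(⟨a⟩)(𝔸) = U(⟨c·a⟩)(𝔸)`,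
★ `coe_frameRetype` ∕ ★ `coe_lineRetype`): the two index data have the same Kronecker Gram `(c d_V) ⊗ (a) = d_V ⊗ (c a)`, hence the same pair
representation (★ `pairRep_rescale`), hence the same kernel (★ `thetaKernelDatum_thetaFun_eq_of_intertwiner` at `R := id`).  At `c = −1`:
`(−d_V, ⟨a⟩) ≡ (d_V, ⟨−a⟩)` — the slot-2 frame `dD ∘ natAdd = −t₀` of #44∕45R read on the line `⟨−a′⟩`.
[cite: Liu2021, App. D §D.1 Step 1 (footnote l. 5215)] [cite: GelbartRogawski1991, §3.1 Prop. 3.1.1 p. 455 L1–2; §3.2 p. 457] [cite: Kudla1994, §3 Thm. 3.1] -/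
theorem lineThetaKer_rescale (c : (Fp L)ˣ)
    (hρc : HasThetaMajorants fun
      (p : ↥(UnitaryGroup.adelic (Fp L) L (IsCMField.complexConj L) N (Matrix.diagonal fun i => ((c : Fp L) : L) * dV i)) ×
        ↥(UnitaryGroup.adelic (Fp L) L (IsCMField.complexConj L) 1 (JW (Fp L) L a)))
      (Φ : piSchwartzBruhat (Fp L) (Fin n₂)) =>
        pairRep (Fp L) L (IsCMField.complexConj L) N 1 e₁ (Matrix.diagonal fun i => ((c : Fp L) : L) * dV i) (JW (Fp L) L a)
          (chiSplittingLine L e₁ (fun i => ((c : Fp L) : L) * dV i) (complexConj_smul_frame L dV c hdV) (smul_frame_ne_zero L dV c hdV0)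
            (toHeckeCharacter L μ) (isUnitary_toHeckeCharacter L μ) ((isOscillatorChar_toHeckeCharacter_iff μ).mpr hμ) (TW (Fp L) a)
            (isUnit_det_TW (Fp L) a) (JW (Fp L) L a) (JW_eq (Fp L) L a))
          p Φ)
    (hρ : HasThetaMajorants fun
      (p : ↥(UnitaryGroup.adelic (Fp L) L (IsCMField.complexConj L) N (Matrix.diagonal dV)) ×
        ↥(UnitaryGroup.adelic (Fp L) L (IsCMField.complexConj L) 1 (JW (Fp L) L (c * a))))
      (Φ : piSchwartzBruhat (Fp L) (Fin n₂)) =>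
        pairRep (Fp L) L (IsCMField.complexConj L) N 1 e₁ (Matrix.diagonal dV) (JW (Fp L) L (c * a))
          (chiSplittingLine L e₁ dV hdV hdV0 (toHeckeCharacter L μ) (isUnitary_toHeckeCharacter L μ)
            ((isOscillatorChar_toHeckeCharacter_iff μ).mpr hμ) (TW (Fp L) (c * a)) (isUnit_det_TW (Fp L) (c * a)) (JW (Fp L) L (c * a))
            (JW_eq (Fp L) L (c * a)))
          p Φ)
    (Φ : piSchwartzBruhat (Fp L) (Fin n₂)) (k : UnitaryGroup.adelic (Fp L) L (IsCMField.complexConj L) N (Matrix.diagonal fun i => ((c : Fp L) : L) * dV i))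
    (u : UnitaryGroup.adelic (Fp L) L (IsCMField.complexConj L) 1 (JW (Fp L) L a)) :
    (lineThetaKernelDatum L N e₁ (fun i => ((c : Fp L) : L) * dV i) (complexConj_smul_frame L dV c hdV) (smul_frame_ne_zero L dV c hdV0)
        μ hμ a hρc).thetaKer Φ (QuotientGroup.mk k, QuotientGroup.mk u) =
      (lineThetaKernelDatum L N e₁ dV hdV hdV0 μ hμ (c * a) hρ).thetaKer Φ
        (QuotientGroup.mk ((MulEquiv.subgroupCongr (adelic_diagonal_smul_frame L dV c)) k),
          QuotientGroup.mk ((MulEquiv.subgroupCongr (adelic_JW_mul L c a).symm) u)) := by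
  have key := thetaKernelDatum_thetaFun_eq_of_intertwiner
    (hs' := isCompatible_chiSplittingLine L e₁ (fun i => ((c : Fp L) : L) * dV i) (complexConj_smul_frame L dV c hdV)
      (smul_frame_ne_zero L dV c hdV0) (toHeckeCharacter L μ) (isUnitary_toHeckeCharacter L μ)
      ((isOscillatorChar_toHeckeCharacter_iff μ).mpr hμ) (TW (Fp L) a) (isSymm_TW (Fp L) a) (isUnit_det_TW (Fp L) a) (JW (Fp L) L a)
      (JW_eq (Fp L) L a)) (hρ' := hρc) (SK' := Set.univ) (hSK' := fun _ _ _ => Set.mem_univ _)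
    (hs := isCompatible_chiSplittingLine L e₁ dV hdV hdV0 (toHeckeCharacter L μ) (isUnitary_toHeckeCharacter L μ)
      ((isOscillatorChar_toHeckeCharacter_iff μ).mpr hμ) (TW (Fp L) (c * a)) (isSymm_TW (Fp L) (c * a)) (isUnit_det_TW (Fp L) (c * a))
      (JW (Fp L) L (c * a)) (JW_eq (Fp L) L (c * a))) (hρ := hρ) (SK := Set.univ) (hSK := fun _ _ _ => Set.mem_univ _)
    (hcδ := complexConj_imagUnit L) (hδ := imagUnit_ne_zero L) (hd := imagUnit_mul_self L)
    (hV' := realDiagonal_isSymm L _ (complexConj_smul_frame L dV c hdV))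
    (hVd' := isUnit_det_realDiagonal L _ (complexConj_smul_frame L dV c hdV) (smul_frame_ne_zero L dV c hdV0))
    (hJV' := (realDiagonal_map L _ (complexConj_smul_frame L dV c hdV)).symm)
    (hV := realDiagonal_isSymm L dV hdV) (hVd := isUnit_det_realDiagonal L dV hdV hdV0) (hJV := (realDiagonal_map L dV hdV).symm)
    ((MulEquiv.subgroupCongr (adelic_diagonal_smul_frame L dV c)).toMonoidHom)
    (MulEquiv.subgroupCongr (adelic_JW_mul L c a).symm) LinearMap.id (fun _ => rfl)
    (fun k u Φ => pairRep_rescale L N e₁ dV hdV hdV0 μ hμ c a k u Φ) Φ k u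
  have key' : (lineThetaKernelDatum L N e₁ (fun i => ((c : Fp L) : L) * dV i) (complexConj_smul_frame L dV c hdV)
        (smul_frame_ne_zero L dV c hdV0) μ hμ a hρc).thetaFun Φ (k, u) =
      (lineThetaKernelDatum L N e₁ dV hdV hdV0 μ hμ (c * a) hρ).thetaFun Φ
        ((MulEquiv.subgroupCongr (adelic_diagonal_smul_frame L dV c)) k, (MulEquiv.subgroupCongr (adelic_JW_mul L c a).symm) u) := key
  exact key'

/-! ## §3 Equal frames ∕ equal lines give equal kernels -/

/-- **equal frames**: for `d_V₁ = d_V₂` (as functions) the line-theta kernels agree, the member `U(diag d_V₁)(𝔸)` retyped along the equality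
(the Weil-majorant witnesses are proof-irrelevant). [cite: Liu2021, App. D §D.1 Steps 1–2 (l. 5217–5219)] -/
theorem lineThetaKer_frame_congr {dV₁ dV₂ : Fin N → L} (h : dV₁ = dV₂)
    (hdV₁ : ∀ i, IsCMField.complexConj L (dV₁ i) = dV₁ i) (hdV₁0 : ∀ i, dV₁ i ≠ 0)
    (hdV₂ : ∀ i, IsCMField.complexConj L (dV₂ i) = dV₂ i) (hdV₂0 : ∀ i, dV₂ i ≠ 0)
    (hρ₁ : HasThetaMajorants fun
      (p : ↥(UnitaryGroup.adelic (Fp L) L (IsCMField.complexConj L) N (Matrix.diagonal dV₁)) ×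
        ↥(UnitaryGroup.adelic (Fp L) L (IsCMField.complexConj L) 1 (JW (Fp L) L a)))
      (Φ : piSchwartzBruhat (Fp L) (Fin n₂)) =>
        pairRep (Fp L) L (IsCMField.complexConj L) N 1 e₁ (Matrix.diagonal dV₁) (JW (Fp L) L a)
          (chiSplittingLine L e₁ dV₁ hdV₁ hdV₁0 (toHeckeCharacter L μ) (isUnitary_toHeckeCharacter L μ)
            ((isOscillatorChar_toHeckeCharacter_iff μ).mpr hμ) (TW (Fp L) a) (isUnit_det_TW (Fp L) a) (JW (Fp L) L a) (JW_eq (Fp L) L a))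
          p Φ)
    (hρ₂ : HasThetaMajorants fun
      (p : ↥(UnitaryGroup.adelic (Fp L) L (IsCMField.complexConj L) N (Matrix.diagonal dV₂)) ×
        ↥(UnitaryGroup.adelic (Fp L) L (IsCMField.complexConj L) 1 (JW (Fp L) L a)))
      (Φ : piSchwartzBruhat (Fp L) (Fin n₂)) =>
        pairRep (Fp L) L (IsCMField.complexConj L) N 1 e₁ (Matrix.diagonal dV₂) (JW (Fp L) L a)
          (chiSplittingLine L e₁ dV₂ hdV₂ hdV₂0 (toHeckeCharacter L μ) (isUnitary_toHeckeCharacter L μ)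
            ((isOscillatorChar_toHeckeCharacter_iff μ).mpr hμ) (TW (Fp L) a) (isUnit_det_TW (Fp L) a) (JW (Fp L) L a) (JW_eq (Fp L) L a))
          p Φ)
    (Φ : piSchwartzBruhat (Fp L) (Fin n₂)) (k : UnitaryGroup.adelic (Fp L) L (IsCMField.complexConj L) N (Matrix.diagonal dV₁))
    (u : UnitaryGroup.adelic (Fp L) L (IsCMField.complexConj L) 1 (JW (Fp L) L a)) :
    (lineThetaKernelDatum L N e₁ dV₁ hdV₁ hdV₁0 μ hμ a hρ₁).thetaKer Φ (QuotientGroup.mk k, QuotientGroup.mk u) =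
      (lineThetaKernelDatum L N e₁ dV₂ hdV₂ hdV₂0 μ hμ a hρ₂).thetaKer Φ
        (QuotientGroup.mk ((MulEquiv.subgroupCongr (congrArg (fun d => UnitaryGroup.adelic (Fp L) L (IsCMField.complexConj L) N
          (Matrix.diagonal d)) h)) k), QuotientGroup.mk u) := by
  subst h
  rfl

/-- **equal lines**: for `a₁ = a₂` in `(L⁺)^×` the line-theta kernels agree, the member `U(⟨a₁⟩)(𝔸)` retyped along the equality (e.g.
`(−1)·a′ = −a′`). [cite: Liu2021, App. D §D.1 Steps 1–2 (l. 5217–5219)] -/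
theorem lineThetaKer_line_congr {a₁ a₂ : (Fp L)ˣ} (h : a₁ = a₂)
    (hρ₁ : HasThetaMajorants fun
      (p : ↥(UnitaryGroup.adelic (Fp L) L (IsCMField.complexConj L) N (Matrix.diagonal dV)) ×
        ↥(UnitaryGroup.adelic (Fp L) L (IsCMField.complexConj L) 1 (JW (Fp L) L a₁)))
      (Φ : piSchwartzBruhat (Fp L) (Fin n₂)) =>
        pairRep (Fp L) L (IsCMField.complexConj L) N 1 e₁ (Matrix.diagonal dV) (JW (Fp L) L a₁)
          (chiSplittingLine L e₁ dV hdV hdV0 (toHeckeCharacter L μ) (isUnitary_toHeckeCharacter L μ)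
            ((isOscillatorChar_toHeckeCharacter_iff μ).mpr hμ) (TW (Fp L) a₁) (isUnit_det_TW (Fp L) a₁) (JW (Fp L) L a₁) (JW_eq (Fp L) L a₁))
          p Φ)
    (hρ₂ : HasThetaMajorants fun
      (p : ↥(UnitaryGroup.adelic (Fp L) L (IsCMField.complexConj L) N (Matrix.diagonal dV)) ×
        ↥(UnitaryGroup.adelic (Fp L) L (IsCMField.complexConj L) 1 (JW (Fp L) L a₂)))
      (Φ : piSchwartzBruhat (Fp L) (Fin n₂)) =>
        pairRep (Fp L) L (IsCMField.complexConj L) N 1 e₁ (Matrix.diagonal dV) (JW (Fp L) L a₂)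
          (chiSplittingLine L e₁ dV hdV hdV0 (toHeckeCharacter L μ) (isUnitary_toHeckeCharacter L μ)
            ((isOscillatorChar_toHeckeCharacter_iff μ).mpr hμ) (TW (Fp L) a₂) (isUnit_det_TW (Fp L) a₂) (JW (Fp L) L a₂) (JW_eq (Fp L) L a₂))
          p Φ)
    (Φ : piSchwartzBruhat (Fp L) (Fin n₂)) (k : UnitaryGroup.adelic (Fp L) L (IsCMField.complexConj L) N (Matrix.diagonal dV))
    (u : UnitaryGroup.adelic (Fp L) L (IsCMField.complexConj L) 1 (JW (Fp L) L a₁)) :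
    (lineThetaKernelDatum L N e₁ dV hdV hdV0 μ hμ a₁ hρ₁).thetaKer Φ (QuotientGroup.mk k, QuotientGroup.mk u) =
      (lineThetaKernelDatum L N e₁ dV hdV hdV0 μ hμ a₂ hρ₂).thetaKer Φ
        (QuotientGroup.mk k, QuotientGroup.mk ((MulEquiv.subgroupCongr (congrArg (fun b => UnitaryGroup.adelic (Fp L) L
          (IsCMField.complexConj L) 1 (JW (Fp L) L b)) h)) u)) := by
  subst h
  rfl

end Summit.HodgeConjecture.HodgeConjecture.Cruxes.HLiu418.K2LiuLineThetaKernelFrameTransport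

end
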